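import Summits.Ventures.PercRepro.S1SpreadTriBasic

/-!
# PercRepro — TRIANGLES OF A SPREAD CORE, PART A: THE COVERED-TRIANGLE LEMMA (p1, gen 35)

`proofs/P1-S2-CORANK6.md` §4r. The basic lemmas are in `S1SpreadTriBasic` (lines of an e-free core have `≤ 3`
points, two distinct triangles share at most one point, under spread a set of rank `≤ r ≤ 5` has `≤ r + 3` points). THE COVERED-TRIANGLE LEMMA (`exists_six_of_covered_tri`): if a
triangle `T = {x, y, z}` has NO PRIVATE POINT — `x`, `y`, `z` lie on three further triangles `Ta`, `Tb`, `Tc` — then the core contains a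
six-point set of rank `≤ 3` (the `M(K₄)` configuration). Proof: `z ∈ cl {x, y} ⊆ cl (Ta ∪ Tb)`, and with `Tc = {z, w₁, w₂}` the rank of
`U = Ta ∪ Tb ∪ Tc` exceeds that of `Ta ∪ Tb` by at most `1`, and by `0` as soon as one of `w₁, w₂` lies in `Ta ∪ Tb`; counting points against
the spread bound leaves only the case `|Ta ∪ Tb| = 5` (the two triangles meet) with `w₁, w₂ ∈ Ta ∪ Tb`, where `U` has six points and rank
`≤ 3`; the case `|Ta ∪ Tb| = 6` with both `w`'s old is killed by the coplanarity of the lines `T` and `Tc` through `z`. Part B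
(`S1SpreadTrianglesCap`) turns this into `s₃ ≤ nullity`. Axioms: standard.
-/

open scoped Matroid

namespace PercRepro

namespace S1

open Set

variable {α : Type}

/-- **THE COVERED-TRIANGLE LEMMA**: a triangle `T = {x, y, z}` whose three points lie on three further triangles `Ta ∋ x`, `Tb ∋ y`,
`Tc ∋ z` forces a six-point set of rank `≤ 3`. -/
theorem exists_six_of_covered_tri (M : Matroid α) [M.Finite]
    (hfree : ∀ e ∈ M.E, ∃ A ⊆ M.E \ {e}, e ∉ M.closure A ∧ e ∉ M.closure ((M.E \ {e}) \ A))
    (hns : ¬ ∃ W ⊆ M.E, W.ncard ≤ 9 ∧ W.encard = M.eRk W + 4)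
    {T Ta Tb Tc : Set α} (hT : M.IsCircuit T) (hT3 : T.ncard = 3) (hTa : M.IsCircuit Ta) (hTa3 : Ta.ncard = 3)
    (hTb : M.IsCircuit Tb) (hTb3 : Tb.ncard = 3) (hTc : M.IsCircuit Tc) (hTc3 : Tc.ncard = 3)
    {x y z : α} (hTxyz : T = {x, y, z}) (hxy : x ≠ y) (hxz : x ≠ z) (hyz : y ≠ z)
    (hxa : x ∈ Ta) (hyb : y ∈ Tb) (hzc : z ∈ Tc) (hTa' : Ta ≠ T) (hTb' : Tb ≠ T) (hTc' : Tc ≠ T) :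
    ∃ W ⊆ M.E, W.ncard = 6 ∧ M.eRk W ≤ 3 := by
  classical
  have hxT : x ∈ T := by rw [hTxyz]; simp
  have hyT : y ∈ T := by rw [hTxyz]; simp
  have hzT : z ∈ T := by rw [hTxyz]; simp
  have hTE := hT.subset_ground
  have hTaE := hTa.subset_ground
  have hTbE := hTb.subset_ground
  have hTcE := hTc.subset_ground
  have hTaf : Ta.Finite := M.ground_finite.subset hTaE
  have hTbf : Tb.Finite := M.ground_finite.subset hTbE
  have hTcf : Tc.Finite := M.ground_finite.subset hTcE
  -- a point of `T` on another triangle `T'` is the only common point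
  have honly : ∀ {T' : Set α}, M.IsCircuit T' → T'.ncard = 3 → T' ≠ T → ∀ {p q : α}, p ∈ T → q ∈ T → p ≠ q →
      p ∈ T' → q ∉ T' := by
    intro T' hT' h3' hne p q hp hq hpq hp' hq'
    exact hne (tri_eq_of_pair_mem M hfree hT' h3' hT hT3 hpq hp' hq' hp hq)
  have hyTa : y ∉ Ta := honly hTa hTa3 hTa' hxT hyT hxy hxa
  have hzTa : z ∉ Ta := honly hTa hTa3 hTa' hxT hzT hxz hxa
  have hxTb : x ∉ Tb := honly hTb hTb3 hTb' hyT hxT hxy.symm hyb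
  have hzTb : z ∉ Tb := honly hTb hTb3 hTb' hyT hzT hyz hyb
  have hxTc : x ∉ Tc := honly hTc hTc3 hTc' hzT hxT hxz.symm hzc
  have hyTc : y ∉ Tc := honly hTc hTc3 hTc' hzT hyT hyz.symm hzc
  -- the two other points of `Tc`
  obtain ⟨w₁, w₂, hw12, hTcw⟩ : ∃ w₁ w₂, w₁ ≠ w₂ ∧ Tc \ {z} = {w₁, w₂} := by
    have : (Tc \ {z}).ncard = 2 := by rw [ncard_sdiff_singleton_of_mem hzc, hTc3]
    exact ncard_eq_two.1 this
  have hw₁c : w₁ ∈ Tc := (show w₁ ∈ Tc \ {z} by rw [hTcw]; simp).1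
  have hw₂c : w₂ ∈ Tc := (show w₂ ∈ Tc \ {z} by rw [hTcw]; simp).1
  have hw₁z : w₁ ≠ z := fun h => (show w₁ ∈ Tc \ {z} by rw [hTcw]; simp).2 (mem_singleton_iff.2 h)
  have hw₂z : w₂ ≠ z := fun h => (show w₂ ∈ Tc \ {z} by rw [hTcw]; simp).2 (mem_singleton_iff.2 h)
  have hTc_eq : Tc = {z, w₁, w₂} := by
    ext t
    constructor
    · intro ht
      by_cases htz : t = z
      · subst htz; simp
      · have : t ∈ Tc \ {z} := ⟨ht, fun h => htz (mem_singleton_iff.1 h)⟩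
        rw [hTcw] at this
        simp only [mem_insert_iff, mem_singleton_iff] at this ⊢
        tauto
    · intro ht
      simp only [mem_insert_iff, mem_singleton_iff] at ht
      rcases ht with rfl | rfl | rfl <;> assumption
  -- the ranks of `Ta ∪ Tb`
  set A := Ta ∪ Tb with hA
  have hAE : A ⊆ M.E := union_subset hTaE hTbE
  have hAf : A.Finite := hTaf.union hTbf
  have hzA : z ∉ A := fun h => h.elim hzTa hzTb
  have hzcl : z ∈ M.closure A :=
    M.closure_subset_closure (show ({x, y} : Set α) ⊆ A by
      rintro s hs; simp only [mem_insert_iff, mem_singleton_iff] at hs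
      rcases hs with rfl | rfl; exact Or.inl hxa; exact Or.inr hyb)
      (tri_subset_closure_pair M hT hT3 hxT hyT hxy hzT)
  -- `U = A ∪ Tc`
  set U := A ∪ Tc with hU
  have hUE : U ⊆ M.E := union_subset hAE hTcE
  have hUf : U.Finite := hAf.union hTcf
  -- rank of `U` via one of the `w`'s: `U ⊆ cl (A ∪ {w})` for either `w`
  have hUsub₁ : U ⊆ M.closure (A ∪ {w₁}) := by
    intro t ht
    rcases ht with ht | ht
    · exact M.subset_closure _ (union_subset hAE (singleton_subset_iff.2 (hTcE hw₁c))) (Or.inl ht)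
    · have hsub : ({z, w₁} : Set α) ⊆ M.closure (A ∪ {w₁}) := by
        rintro s hs; simp only [mem_insert_iff, mem_singleton_iff] at hs
        rcases hs with rfl | rfl
        · exact M.closure_subset_closure subset_union_left hzcl
        · exact M.subset_closure _ (union_subset hAE (singleton_subset_iff.2 (hTcE hw₁c))) (Or.inr rfl)
      exact M.closure_subset_closure_of_subset_closure hsub (tri_subset_closure_pair M hTc hTc3 hzc hw₁c hw₁z.symm ht)
  have hUsub₂ : U ⊆ M.closure (A ∪ {w₂}) := by
    intro t ht
    rcases ht with ht | ht
    · exact M.subset_closure _ (union_subset hAE (singleton_subset_iff.2 (hTcE hw₂c))) (Or.inl ht)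
    · have hsub : ({z, w₂} : Set α) ⊆ M.closure (A ∪ {w₂}) := by
        rintro s hs; simp only [mem_insert_iff, mem_singleton_iff] at hs
        rcases hs with rfl | rfl
        · exact M.closure_subset_closure subset_union_left hzcl
        · exact M.subset_closure _ (union_subset hAE (singleton_subset_iff.2 (hTcE hw₂c))) (Or.inr rfl)
      exact M.closure_subset_closure_of_subset_closure hsub (tri_subset_closure_pair M hTc hTc3 hzc hw₂c hw₂z.symm ht)
  have hrU₁ : M.eRk U ≤ M.eRk (A ∪ {w₁}) := by
    have := M.eRk_mono hUsub₁; rwa [Matroid.eRk_closure_eq] at this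
  have hrU₂ : M.eRk U ≤ M.eRk (A ∪ {w₂}) := by
    have := M.eRk_mono hUsub₂; rwa [Matroid.eRk_closure_eq] at this
  have hrU : M.eRk U ≤ M.eRk A + 1 :=
    hrU₁.trans ((M.eRk_union_le_eRk_add_encard A {w₁}).trans (by rw [encard_singleton]))
  have hrU_old : w₁ ∈ A ∨ w₂ ∈ A → M.eRk U ≤ M.eRk A := by
    rintro (h | h)
    · have : A ∪ {w₁} = A := by rw [union_singleton, insert_eq_of_mem h]
      rw [this] at hrU₁; exact hrU₁
    · have : A ∪ {w₂} = A := by rw [union_singleton, insert_eq_of_mem h]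
      rw [this] at hrU₂; exact hrU₂
  -- sizes
  have hUcard : U.ncard = A.ncard + (Tc \ A).ncard := by
    rw [hU, ← Set.ncard_union_eq (disjoint_sdiff_right) hAf (hTcf.subset sdiff_subset), union_sdiff_self]
  have hTcA : Tc \ A = insert z ({w₁, w₂} \ A) := by
    rw [hTc_eq]
    ext t
    simp only [mem_sdiff, mem_insert_iff, mem_singleton_iff]
    constructor
    · rintro ⟨h, hA⟩
      rcases h with rfl | h
      · exact Or.inl rfl
      · exact Or.inr ⟨h, hA⟩
    · rintro (rfl | ⟨h, hA⟩)
      · exact ⟨Or.inl rfl, hzA⟩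
      · exact ⟨Or.inr h, hA⟩
  have hzw : z ∉ ({w₁, w₂} : Set α) \ A := by
    simp only [mem_sdiff, mem_insert_iff, mem_singleton_iff, not_and]
    intro h; rcases h with h | h
    · exact absurd h.symm hw₁z
    · exact absurd h.symm hw₂z
  have hTcAcard : (Tc \ A).ncard = 1 + (({w₁, w₂} : Set α) \ A).ncard := by
    rw [hTcA, ncard_insert_of_notMem hzw (toFinite _), add_comm]
  -- the rank of `A`: `≤ 3` when `Ta`, `Tb` meet, `≤ 4` otherwise
  have hrA : M.eRk A ≤ 4 := by
    have := M.eRk_union_le_eRk_add_eRk Ta Tb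
    rw [eRk_eq_two_of_tri M hTa hTa3, eRk_eq_two_of_tri M hTb hTb3] at this
    exact this.trans (by norm_num)
  have hrA3 : (Ta ∩ Tb).Nonempty → M.eRk A ≤ 3 := by
    rintro ⟨u, hu⟩
    have hsub := M.eRk_submod Ta Tb
    rw [eRk_eq_two_of_tri M hTa hTa3, eRk_eq_two_of_tri M hTb hTb3] at hsub
    have h1 : 1 ≤ M.eRk (Ta ∩ Tb) := by
      rw [← eRk_singleton_eq_one_of_hfree M hfree (hTaE hu.1)]
      exact M.eRk_mono (singleton_subset_iff.2 hu)
    obtain ⟨r, hr⟩ := exists_eRk_eq_coe M A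
    obtain ⟨s, hs⟩ := exists_eRk_eq_coe M (Ta ∩ Tb)
    rw [hr, hs] at hsub; rw [hs] at h1; rw [hr]
    have : s + r ≤ 2 + 2 := by exact_mod_cast hsub
    have : 1 ≤ s := by exact_mod_cast h1
    exact_mod_cast (show r ≤ 3 by omega)
  have hAcard : A.ncard = 6 - (Ta ∩ Tb).ncard := by
    have := Set.ncard_union_add_ncard_inter Ta Tb hTaf hTbf
    rw [hTa3, hTb3, ← hA] at this
    omega
  have hinter : (Ta ∩ Tb).ncard ≤ 1 := by
    by_contra hlt
    push Not at hlt
    obtain ⟨p, hp, q, hq, hpq⟩ := (Set.one_lt_ncard (hTaf.subset inter_subset_left)).1 hlt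
    exact hTa' (by
      have := tri_eq_of_pair_mem M hfree hTa hTa3 hTb hTb3 hpq hp.1 hq.1 hp.2 hq.2
      -- `Ta = Tb` contradicts `x ∈ Ta`, `x ∉ Tb`
      exact absurd (this ▸ hxa) hxTb)
  -- the spread bound on `U`
  have hspread : ∀ r : ℕ, r ≤ 5 → M.eRk U ≤ r → U.ncard ≤ r + 3 := fun r hr5 hr =>
    ncard_le_add_three_of_eRk_le M hns hUE hr5 hr
  -- convert the rank of `A` to a natural number
  obtain ⟨rA, hrA'⟩ := exists_eRk_eq_coe M A
  have hrA4 : rA ≤ 4 := by rw [hrA'] at hrA; exact_mod_cast hrA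
  -- case analysis on how many of `w₁, w₂` are new
  by_cases hold : w₁ ∈ A ∨ w₂ ∈ A
  · -- at least one `w` is old: `rank U ≤ rank A`
    have hrU' : M.eRk U ≤ rA := by rw [← hrA']; exact hrU_old hold
    have hnew : (({w₁, w₂} : Set α) \ A).ncard ≤ 1 := by
      rcases hold with h | h
      · have : ({w₁, w₂} : Set α) \ A ⊆ {w₂} := by
          intro t ht; simp only [mem_sdiff, mem_insert_iff, mem_singleton_iff] at ht
          rcases ht.1 with rfl | rfl
          · exact absurd h ht.2
          · rfl
        exact (ncard_le_ncard this (toFinite _)).trans (by simp)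
      · have : ({w₁, w₂} : Set α) \ A ⊆ {w₁} := by
          intro t ht; simp only [mem_sdiff, mem_insert_iff, mem_singleton_iff] at ht
          rcases ht.1 with rfl | rfl
          · rfl
          · exact absurd h ht.2
        exact (ncard_le_ncard this (toFinite _)).trans (by simp)
    by_cases hmeet : (Ta ∩ Tb).Nonempty
    · -- `|A| = 5`, `rank A ≤ 3`
      have hA5 : A.ncard = 5 := by
        have : (Ta ∩ Tb).ncard = 1 := by
          have := (ncard_pos (hTaf.subset inter_subset_left)).2 hmeet; omega
        rw [hAcard, this]
      have hrA3' : rA ≤ 3 := by have := hrA3 hmeet; rw [hrA'] at this; exact_mod_cast this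
      rcases Nat.eq_zero_or_pos (({w₁, w₂} : Set α) \ A).ncard with h0 | hpos
      · -- both old: `|U| = 6`, `rank U ≤ 3`: the six-point set
        refine ⟨U, hUE, ?_, hrU'.trans (by exact_mod_cast hrA3')⟩
        rw [hUcard, hTcAcard, hA5, h0]
      · -- one new: `|U| = 7`, `rank ≤ 3`: impossible
        exfalso
        have h7 : U.ncard = 7 := by rw [hUcard, hTcAcard, hA5]; omega
        have := hspread 3 (by norm_num) (hrU'.trans (by exact_mod_cast hrA3'))
        omega
    · -- `|A| = 6`, `rank A ≤ 4`
      have hA6 : A.ncard = 6 := by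
        have : (Ta ∩ Tb).ncard = 0 := by
          rw [Set.not_nonempty_iff_eq_empty] at hmeet; rw [hmeet]; simp
        rw [hAcard, this]
      rcases Nat.eq_zero_or_pos (({w₁, w₂} : Set α) \ A).ncard with h0 | hpos
      · -- both old, `Ta`, `Tb` disjoint: the lines `T` and `Tc` meet at `z`, so everything is coplanar
        exfalso
        have hw₁A : w₁ ∈ A := by
          by_contra h
          have : w₁ ∈ ({w₁, w₂} : Set α) \ A := ⟨by simp, h⟩
          rw [ncard_eq_zero (toFinite _)] at h0
          rw [h0] at this; exact this
        have hw₂A : w₂ ∈ A := by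
          by_contra h
          have : w₂ ∈ ({w₁, w₂} : Set α) \ A := ⟨by simp, h⟩
          rw [ncard_eq_zero (toFinite _)] at h0
          rw [h0] at this; exact this
        -- `T ∪ Tc` has rank `≤ 3` (two lines through `z`)
        have hTTc : M.eRk (T ∪ Tc) ≤ 3 := by
          have hsub := M.eRk_submod T Tc
          rw [eRk_eq_two_of_tri M hT hT3, eRk_eq_two_of_tri M hTc hTc3] at hsub
          have h1 : 1 ≤ M.eRk (T ∩ Tc) := by
            rw [← eRk_singleton_eq_one_of_hfree M hfree (hTE hzT)]
            exact M.eRk_mono (singleton_subset_iff.2 ⟨hzT, hzc⟩)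
          obtain ⟨r, hr⟩ := exists_eRk_eq_coe M (T ∪ Tc)
          obtain ⟨s, hs⟩ := exists_eRk_eq_coe M (T ∩ Tc)
          rw [hr, hs] at hsub; rw [hs] at h1; rw [hr]
          have : s + r ≤ 2 + 2 := by exact_mod_cast hsub
          have : 1 ≤ s := by exact_mod_cast h1
          exact_mod_cast (show r ≤ 3 by omega)
        -- `Ta ⊆ cl (T ∪ Tc)` and `Tb ⊆ cl (T ∪ Tc)`: each contains a point of `T` and a point of `Tc`
        have hwTa : w₁ ∈ Ta ∨ w₂ ∈ Ta := by
          by_contra h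
          push Not at h
          have h1 : w₁ ∈ Tb := hw₁A.resolve_left h.1
          have h2 : w₂ ∈ Tb := hw₂A.resolve_left h.2
          have := tri_eq_of_pair_mem M hfree hTc hTc3 hTb hTb3 hw12 hw₁c hw₂c h1 h2
          exact hzTb (this ▸ hzc)
        have hwTb : w₁ ∈ Tb ∨ w₂ ∈ Tb := by
          by_contra h
          push Not at h
          have h1 : w₁ ∈ Ta := hw₁A.resolve_right h.1
          have h2 : w₂ ∈ Ta := hw₂A.resolve_right h.2
          have := tri_eq_of_pair_mem M hfree hTc hTc3 hTa hTa3 hw12 hw₁c hw₂c h1 h2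
          exact hzTa (this ▸ hzc)
        have hTTcE : T ∪ Tc ⊆ M.E := union_subset hTE hTcE
        have hTa_sub : Ta ⊆ M.closure (T ∪ Tc) := by
          rcases hwTa with hw | hw
          · have hne : x ≠ w₁ := fun h => hxTc (h ▸ hw₁c)
            exact (tri_subset_closure_pair M hTa hTa3 hxa hw hne).trans
              (M.closure_subset_closure (by rintro s hs; simp only [mem_insert_iff, mem_singleton_iff] at hs
                                            rcases hs with rfl | rfl; exact Or.inl hxT; exact Or.inr hw₁c))
          · have hne : x ≠ w₂ := fun h => hxTc (h ▸ hw₂c)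
            exact (tri_subset_closure_pair M hTa hTa3 hxa hw hne).trans
              (M.closure_subset_closure (by rintro s hs; simp only [mem_insert_iff, mem_singleton_iff] at hs
                                            rcases hs with rfl | rfl; exact Or.inl hxT; exact Or.inr hw₂c))
        have hTb_sub : Tb ⊆ M.closure (T ∪ Tc) := by
          rcases hwTb with hw | hw
          · have hne : y ≠ w₁ := fun h => hyTc (h ▸ hw₁c)
            exact (tri_subset_closure_pair M hTb hTb3 hyb hw hne).trans
              (M.closure_subset_closure (by rintro s hs; simp only [mem_insert_iff, mem_singleton_iff] at hs
                                            rcases hs with rfl | rfl; exact Or.inl hyT; exact Or.inr hw₁c))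
          · have hne : y ≠ w₂ := fun h => hyTc (h ▸ hw₂c)
            exact (tri_subset_closure_pair M hTb hTb3 hyb hw hne).trans
              (M.closure_subset_closure (by rintro s hs; simp only [mem_insert_iff, mem_singleton_iff] at hs
                                            rcases hs with rfl | rfl; exact Or.inl hyT; exact Or.inr hw₂c))
        have hUsub : U ⊆ M.closure (T ∪ Tc) := by
          intro t ht
          rcases ht with (ht | ht) | ht
          · exact hTa_sub ht
          · exact hTb_sub ht
          · exact M.subset_closure _ hTTcE (Or.inr ht)
        have hrU3 : M.eRk U ≤ 3 := by
          have := M.eRk_mono hUsub; rw [Matroid.eRk_closure_eq] at this; exact this.trans hTTc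
        have h7 : U.ncard = 7 := by rw [hUcard, hTcAcard, hA6, h0]
        have := hspread 3 (by norm_num) hrU3
        omega
      · -- one new: `|U| = 8`, `rank ≤ 4`: impossible
        exfalso
        have h8 : U.ncard = 8 := by rw [hUcard, hTcAcard, hA6]; omega
        have := hspread 4 (by norm_num) (hrU'.trans (by exact_mod_cast hrA4))
        omega
  · -- both `w`'s new: `|U| = |A| + 3`, `rank U ≤ rank A + 1`: impossible
    exfalso
    push Not at hold
    have hnew : (({w₁, w₂} : Set α) \ A).ncard = 2 := by
      have : ({w₁, w₂} : Set α) \ A = {w₁, w₂} := by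
        ext t; simp only [mem_sdiff, mem_insert_iff, mem_singleton_iff]
        constructor
        · exact fun h => h.1
        · rintro (rfl | rfl)
          · exact ⟨Or.inl rfl, hold.1⟩
          · exact ⟨Or.inr rfl, hold.2⟩
      rw [this, ncard_pair hw12]
    have hrU' : M.eRk U ≤ rA + 1 := by
      have := hrU; rw [hrA'] at this; exact_mod_cast this
    by_cases hmeet : (Ta ∩ Tb).Nonempty
    · have hA5 : A.ncard = 5 := by
        have : (Ta ∩ Tb).ncard = 1 := by
          have := (ncard_pos (hTaf.subset inter_subset_left)).2 hmeet; omega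
        rw [hAcard, this]
      have hrA3' : rA ≤ 3 := by have := hrA3 hmeet; rw [hrA'] at this; exact_mod_cast this
      have h8 : U.ncard = 8 := by rw [hUcard, hTcAcard, hA5, hnew]
      have := hspread 4 (by norm_num) (hrU'.trans (by exact_mod_cast (show rA + 1 ≤ 4 by omega)))
      omega
    · have hA6 : A.ncard = 6 := by
        have : (Ta ∩ Tb).ncard = 0 := by
          rw [Set.not_nonempty_iff_eq_empty] at hmeet; rw [hmeet]; simp
        rw [hAcard, this]
      have h9 : U.ncard = 9 := by rw [hUcard, hTcAcard, hA6, hnew]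
      have := hspread 5 (by norm_num) (hrU'.trans (by exact_mod_cast (show rA + 1 ≤ 5 by omega)))
      omega

end S1

end PercRepro
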